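import Summits.Ventures.QEC.Census.CertCheckBZMitmAssembly
import Summits.Ventures.QEC.Theorems.BB144DistanceCertificateLowerZSem
import Summits.Ventures.QEC.Theorems.BB144DistanceCertificateLowerZ4
import HarnessLib

/-!
# `[[144,12,12]]` KERNEL-std programme — per-block adapter for lane β (meet-in-the-middle parts ⇒ block bound)

For a representative block `b` of the `bz_aut` data (`bzAutData`, 15 blocks, qec-search-7; or `bzAut4Data`, 4 blocks,
qec-search-10) the KERNEL parts — information-set facts `cert.bzZSys … b i`, the relative-rank bound
`cert.bzZBound … b`, and qec-search-9's meet-in-the-middle parts `cert.bzZMitm … b i p` (`p < mitmParts 10 = 15`) —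
give the block's SEMANTIC bound «every non-trivial flat `Z`-logical with label in `span W_b` has weight `> 10`»
through search-9's `block_sound_mitm` and the `DistCert` bridges. Feeding the 15 (or 4) block bounds to
`twelve_le_flat_of_blockBounds15` (`…4`) and `BB.bb144.zLowerBound_of_flat rfl rfl` is the KERNEL-std closer.
-/

namespace Summit.Ventures.QEC.Census.BB144

open Matrix Literature.InformationTheory.QuantumCodes

/-- One block's SEMANTIC bound from its KERNEL parts: the information-set facts of its matrices, its relative-rank
bound, and its meet-in-the-middle parts (qec-search-9's `block_sound_mitm`). -/
theorem blockBound15_of_mitm (b : Fin bzAutData.sideZ.blocks.length)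
    (hsys : ∀ (i : ℕ) (hi : i < (bzAutData.sideZ.blocks[b]).mats.length), cert.bzZSys bzAutData b i = true)
    (hbd : cert.bzZBound bzAutData b = true)
    (hm : ∀ (i p : ℕ) (hi : i < (bzAutData.sideZ.blocks[b]).mats.length), p < mitmParts 10 →
      cert.bzZMitm bzAutData b i p = true)
    (z : Fin cert.n → ZMod 2) (hz : rowMatrix cert.n cert.HX *ᵥ z = 0) (hz' : z ∉ rowSpace (rowMatrix cert.n cert.HZ))
    (hlab : ldMat cert.n bzAutData.LZ bzAutData.LX *ᵥ z ∈ Submodule.span (ZMod 2)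
      (Set.range fun l : Fin (bzAutData.sideZ.blocks[b]).W.length =>
        ofBits bzAutData.LZ.length (bzAutData.sideZ.blocks[b]).W[l])) :
    10 < hammingNorm z := by
  have hcore := core_ok
  simp only [bzCoreOK, Bool.and_eq_true, beq_iff_eq] at hcore
  obtain ⟨⟨⟨⟨hY, hS⟩, hL⟩, hdim⟩, -⟩ := hcore
  have hlen := len_ok
  simp only [DistCert.bzZLen, bzLenOK, List.all_eq_true] at hlen
  have h := block_sound_mitm (target := 11) (by decide : 0 < cert.n) comm_flat hY hS hL hdim foundZ_ok
    (bzAutData.sideZ.blocks[b])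
    (fun i => cert.matrixSysOK_of_bzZSys bzAutData b.2 i.2 (hsys i i.2))
    (cert.le_of_bzZBound bzAutData b.2 hbd)
    (fun i p hp => cert.mitmPart_of_bzZMitm bzAutData b.2 i.2 (hm i p i.2 hp))
    (by rw [List.all_eq_true]; exact hlen _ (List.getElem_mem b.2))
    hz hz' hlab
  omega

/-- The same for the 4-block orbit-cover data `bzAut4Data` (qec-search-10). -/
theorem blockBound4_of_mitm (b : Fin bzAut4Data.sideZ.blocks.length)
    (hsys : ∀ (i : ℕ) (hi : i < (bzAut4Data.sideZ.blocks[b]).mats.length), cert.bzZSys bzAut4Data b i = true)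
    (hbd : cert.bzZBound bzAut4Data b = true)
    (hm : ∀ (i p : ℕ) (hi : i < (bzAut4Data.sideZ.blocks[b]).mats.length), p < mitmParts 10 →
      cert.bzZMitm bzAut4Data b i p = true)
    (z : Fin cert.n → ZMod 2) (hz : rowMatrix cert.n cert.HX *ᵥ z = 0) (hz' : z ∉ rowSpace (rowMatrix cert.n cert.HZ))
    (hlab : ldMat cert.n bzAut4Data.LZ bzAut4Data.LX *ᵥ z ∈ Submodule.span (ZMod 2)
      (Set.range fun l : Fin (bzAut4Data.sideZ.blocks[b]).W.length =>
        ofBits bzAut4Data.LZ.length (bzAut4Data.sideZ.blocks[b]).W[l])) :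
    10 < hammingNorm z := by
  have hcore := core4_ok
  simp only [bzCoreOK, Bool.and_eq_true, beq_iff_eq] at hcore
  obtain ⟨⟨⟨⟨hY, hS⟩, hL⟩, hdim⟩, -⟩ := hcore
  have hlen := len4_ok
  simp only [DistCert.bzZLen, bzLenOK, List.all_eq_true] at hlen
  have h := block_sound_mitm (target := 11) (by decide : 0 < cert.n) comm_flat hY hS hL hdim foundZ_ok
    (bzAut4Data.sideZ.blocks[b])
    (fun i => cert.matrixSysOK_of_bzZSys bzAut4Data b.2 i.2 (hsys i i.2))
    (cert.le_of_bzZBound bzAut4Data b.2 hbd)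
    (fun i p hp => cert.mitmPart_of_bzZMitm bzAut4Data b.2 i.2 (hm i p i.2 hp))
    (by rw [List.all_eq_true]; exact hlen _ (List.getElem_mem b.2))
    hz hz' hlab
  omega

end Summit.Ventures.QEC.Census.BB144
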